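import Literature.NumberTheory.EllipticCurves.CastellaHsuKunduLeeLiu2025.SignedBipartiteEulerSystem
import Literature.NumberTheory.EllipticCurves.CastellaWan2024.GreenbergMainConjectureBDP
import Literature.NumberTheory.EllipticCurves.ZhangLevelRaisedKolyvaginData
import Literature.NumberTheory.EllipticCurves.Rank1Residual.Predicates
import Literature.NumberTheory.Automorphic.BrandtGrossPoints
import Literature.NumberTheory.Automorphic.BrandtEigenLine
import Summits.BirchSwinnertonDyer.BirchSwinnertonDyer.Theorems.SignedBaseChangeAnticyclotomicEisensteinDivisibilityAdmdefBipartiteNVLevelOne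
import HarnessLib

/-!
# Line `admdef` — TYPING SPEC for the BRIDGE stub `stub_bipartiteBridge : SignedBipartiteBridgeNS` (LEAD bsd-line-sbc-p1 gen 19;
# crux `AnticyclotomicEisensteinDivisibility`, stmt-BirchSwinnertonDyer-20727) — NOT a skeleton, NOT a Literature proposal
# v2 (LEAD gen 20): WEIGHTED toric period `Σ_𝔞 w(x_𝔞) φ(x_𝔞)` in `SpecP0P1`'s dictionary and in the BRIDGE text (= skeleton v14)

v2 (LEAD gen 20, FINDING F6 — weights-convention slip of v1/v13 REPAIRED).  The tree's `Brandt.eigenSpace (ZMod p) (N·m) (Brandt.matrix S.O) a`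
is the simultaneous eigenspace for `Matrix.mulVec` of the Brandt matrices `T(ℓ)_{ij} = #{J ⊆ I_j : [I_j : J] = ℓ², [J] = [I_i]}` (column sums
`ℓ + 1`), i.e. the DIVISOR convention on `ℤ[Cls O]` (the constant vector is a `vecMul`-eigenvector; `Brandt.matrix` is self-adjoint for Gross's
pairing `Σ_i w_i x_i y_i`, `BrandtWeightedPairing.lean`); print's quaternionic eigenFORM (Gross 1987 §11; Vatsal 2004 (7-5); BD05/DI08
`f(σ ⋆ v)`; CHKLL25 §7.3; PW11) is the FUNCTION `i ↦ w_i φ_i`, `w = Brandt.weight S.O`.  So DI's sum `Σ_σ f_g(σ ⋆ v_0)` attached to the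
tree's `mulVec`-eigenvector `φ_g` is the WEIGHTED class sum `Σ_𝔞 w(x_𝔞) φ_g(x_𝔞) = Brandt.toricPeriod S.O ψ I (w • φ_g)` — exactly as the
tree's typing of the explicit Gross/Waldspurger formula reads it (`CaiShuTian2014.thm12_trivialChar`: «`(Σ_𝔞 w(x_𝔞) v(x_𝔞))² / Σ_i w_i v_i²`»
for a `mulVec`-eigenvector `v`, «in the printed "function" normalisation `f(g_i) = w_i v_i`»).  v1's flag (α) («`toricPeriod` is the UNWEIGHTED
class sum = DI's `f(σ ⋆ v_0)` sum») conflated the two conventions; the weights `w_i ∈ {1,2,3,4,6,12}` are `p`-units (`p ≥ 5`) but VARY along a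
`Pic(𝓞_K)`-orbit (witness `(N⁺,N⁻) = (1,11)`, `K = ℚ(√−15)`: orbit `{[j=0],[j=1728]}`, weights `(3,2)`, `T(2) = [[0,2],[3,1]]`, eigen-divisor of
`11a1` `(1,−1)`: unweighted sum `0`, weighted sum `1`), so the two functionals are genuinely different.  CHANGE: one token in `SpecP0P1`
(dictionary clause) and one in the BRIDGE text: `Brandt.toricPeriod S.O ψ I φ` ⟶ `Brandt.toricPeriod S.O ψ I (fun i ↦ (Brandt.weight S.O i :
ZMod p) * φ i)`; `SpecMult1` unchanged; the kernel glue re-proved (`weight_mul_smul`).  LEAD memo `Lines/admdef-lead-g20.md`.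

PURPOSE.  Since v6 (LEAD gen 16) the registered stub `stub_bipartiteBridge` is labelled «PRINT-construction pending typing
(typer rows P0 + P1)».  This workfile states, IN THE TREE'S VOCABULARY and elaborating against the current tree, the two
named facts a literature-typer row would land, and PROVES in kernel that the registered BRIDGE text follows from them:

* `SpecP0P1` (= P0 + P1 as ONE joint fact, because both are about THE SAME system `B`): Castella–Hsu–Kundu–Lee–Liu 2025
  Thm. 7.4 (Darmon–Iovita / Pollack–Weston signed bipartite Euler system) TOGETHER WITH (7.1) = (7.2) (p. 31 L9–12: «comparing
  the construction of the classes `κ±_j(m)` in [DI08, §4] and the construction of the classes `z_∞[S]±` in [CW24, §4.1], we see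
  that (7.2) is the same as the class `κ±_∞` in (7.1)»), Castella–Wan 2024 §4 + proof of Thm. 6.8 (the transfer inputs hold for
  THAT class), and §7.3 p. 32 L50–63 («from the construction of the elements `λ±_j(m)`, it follows that if `g` is level-raising `f`
  at `m ∈ 𝒩_j^def`, then the image of `Θ±_∞(g/K)` … modulo `℘^j` is the same as `λ±_j(m)`») READ AT THE TRIVIAL CHARACTER and at
  `j = 1` through Darmon–Iovita's construction (DI08 §2.2: `L_n = ν(L̃_{n+1})`, `L̃_n = Σ_σ g(σ ⋆ v_n) σ⁻¹`, relation (8)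
  `π(L_{n+1}) = −ξ_n L_{n−1}` from `a_p(g) ≡ 0`; read at the LOWEST layer of each parity — `n = 0` for `+`, `n = 1` for `−` — it gives
  `λ⁺_1(m)(𝟙) ≐ ±2·P_K(φ_g)` and `λ⁻_1(m)(𝟙) ≐ ±((p−1)/u_K)·P_K(φ_g)`, BOTH unit multiples (`p ≥ 5`) of the conductor-1 toric period
  `P_K(φ_g) = Σ_{[𝔞] ∈ Pic(𝓞_K)} φ_g([ψ(𝔞)I])` of the mod-`p` Jacquet–Langlands eigenvector `φ_g` of the level-raised form on
  the definite quaternion algebra of discriminant `m` with Eichler level `N`; LEAD memo g19 §2 (F2)).  Shape: ∃ frame, ∃ Heegner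
  family `F`, ∀ sign, ∃ class `z` ∃ system `B`: laws ∧ limit base class `z` ∧ `z` IS the signed Heegner class of `F` ∧ transfer
  inputs for `z` ∧ DICTIONARY at `j = 1` («∃ φ_g ≠ 0 in the `a(E)`-eigenspace with `λ_1(m)(0) ∈ ℤ_pˣ ⟺ P_K(φ_g) ≠ 0`»).
* `SpecMult1` (multiplicity one mod `p` on the definite side): the `a(E)`-eigenspace of the mod-`p` Brandt module of level
  `(N, m)` is spanned by any of its non-zero vectors (Pollack–Weston 2011 Thm. 6.2 / Helm at square-free `N`; Kim–Ota 2023 §5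
  (freeness, CR⁺) at general `N⁺`, the «koeta» print located by bsd-idea-5 g21; typer flag `mult-one-socle-vs-cosocle`).
* KERNEL (this file, 0 sorry): `bridge_text_of_spec : SpecP0P1 → SpecMult1 → <the registered text of SignedBipartiteBridgeNS, verbatim>`.

So the BRIDGE stub is CLOSED MODULO EXACTLY these two typed texts (rule (d) «skeleton closed modulo X»): when a typer lands them
under `Literature/…` (any names), `stub_bipartiteBridge := bridge_text_of_spec citeP0P1 citeMult1` and v13 has 4 stubs.
HONESTY: the two `def … : Prop` below are NOT asserted and NOT proposed to `Literature/` by this seat (LEAD-adjacent to its own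
bridge; left to the typer row / reviewer — the LEAD offers to propose them verbatim if the director authorises).  Flags for the
typer: (α) [v2] the period is the WEIGHTED class sum `toricPeriod S.O ψ I (w • φ)`, `w = Brandt.weight S.O` (= DI's `f(σ ⋆ v_0)` sum for the
eigenFUNCTION `f = w • φ`; the tree's `mulVec` eigenvectors are divisors; cf. `CaiShuTian2014.thm12_trivialChar`); (β) `j = 1` only (weaker than print); (γ) the existential `F` (Castella–Wan's own family; a rescaled family `m·F` needs
`m²·L`, flag `heegner-normalisation` of conjunct 3); (δ) `u_K = 1` is automatic on the crux frame (`Odd D_K`, `D_K ≠ −3`) but the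
dictionary is stated for all `K` since `2`, `(p−1)/2`, `(p−1)/3` are units for `p ≥ 5`; (ε) the DICTIONARY is a consequence of a
printed sentence + a DEFINITION unfolding (DI08 §2.2), not a verbatim printed statement — the typer may prefer to type the
`Λ/ω_n`-level congruence `ω̃_n^{−ε}·λ ≡ ±L_n(φ_g)` against the tree's `GrossPointTower.lAc` and derive the `𝟙`-value form in kernel.
No summit statement, crux or stub is proved here; BSD is not proved by any of this.

References: [cite: CastellaEtAl2025, Thm. 7.4, (7.1)–(7.2), §7.2 p. 31 L9–12, §7.3 p. 32 L50–63, (7.4), §7.4 L1–3 (arXiv:2308.10474v2 pp. 29–33)]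
[cite: CastellaWan2023, Prop. 4.1, (4.1), Prop. 4.4, Def. 4.5, §4.2, Def. 6.1, Thm. 6.2, Cor. 6.4, Lemma 6.7, proof of Thm. 6.8 (MS pp. 18–31)]
[cite: DarmonIovita2008, §2.2 (L̃_n, Lemma 2.6, (8), Prop. 2.8, Lemma 2.9), Prop. 4.3, Prop. 4.4, Prop. 4.6] [cite: BertoliniDarmon2005, Thm. 5.15]
[cite: PollackWeston2011, §4.3, Thm. 6.2] [cite: KimOta2023, Thm. 1.3, Cor. 5.7 (arXiv:1905.02926)] [cite: Howard2006, §3.2 (15)–(16), Thm. 3.2.3].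
-/

-- D-0017: single-problem summit, the namespace repeats the problem name by design.
set_option linter.dupNamespace false
set_option autoImplicit false

noncomputable section

open scoped Classical
open NumberField IsDedekindDomain Field
open Literature.NumberTheory.EllipticCurves Literature.NumberTheory.EllipticCurves.ModularForms
  Literature.NumberTheory.EllipticCurves.Rank1Residual Literature.NumberTheory.EllipticCurves.CastellaWan2024
  Literature.NumberTheory.EllipticCurves.AcSigned Literature.NumberTheory.EllipticCurves.BertoliniDarmon2005
  Literature.NumberTheory.EllipticCurves.CastellaHsuKunduLeeLiu2025
  Literature.NumberTheory.GaloisRepresentations Literature.NumberTheory.Automorphic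
open Summit.BirchSwinnertonDyer.BirchSwinnertonDyer.Theorems

namespace Summit.BirchSwinnertonDyer.BirchSwinnertonDyer.Cruxes.AnticyclotomicEisensteinDivisibility.AdmdefBridgeSpec

/-! ## §1 The two typing targets (statements only; NOT asserted; candidate Literature texts for the typer row) -/

/-- **Typing target P0+P1 (joint): CHKLL25 Thm. 7.4 WITH its construction — the signed bipartite system through Castella–Wan's
signed Heegner class, the transfer inputs for THAT class, and the Darmon–Iovita dictionary for `λ±_1(m)` at the trivial character.**
Binders = those of the typed `thm74_exists_signedBipartiteSystem` (`AcSigned.Setting`, `N = N_E`, `N⁻ = 1`, `(N, D_K) = 1`, `5 ≤ p`,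
CR = `Surj`) plus those of conjunct 3 `castellaWan2024_proofThm68_transferInputs` (embedding datum `ι` inducing `𝔭`, newform `f`,
topological generator, non-split datum at `𝔭`).  Conclusion: a Castella–Wan BDP frame `(Ω_K ≠ 0, Ω_p, L)`; a trace-coherent Heegner
family `F` of level `N` (Castella–Wan's own, Prop. 4.1); and FOR EACH SIGN `ε` a class `z ∈ 𝒮_ε` and a system `B` with: the laws
(`IsSignedBipartiteSystem … N ε B`), `z` its limit base class ((7.2)), `z` the `ε`-signed Heegner class of `F` (Prop. 4.4/Def. 4.5),
the transfer inputs of the proof of CW24 Thm. 6.8 for `(z, L)`, and the DICTIONARY at `j = 1`: for every `m ∈ 𝒩_1^def` and every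
definite set-up `S` of type `(N, m)` there is a NON-ZERO mod-`p` Hecke eigenvector `φ_g` on `Cls(S.O)` for the eigenvalues `a_ℓ(E)`,
`ℓ ∤ Nm` (the Jacquet–Langlands vector of the level-raised form `g_m`, BD05 Thm. 5.15 / CHKLL Rem. 7.3), such that for every Gross
point `(ψ, I)` of conductor `1`: `λ_1(m)(0) ∈ ℤ_pˣ ⟺ P_K(w • φ_g) ≠ 0`, `P_K(w • φ_g) = Σ_𝔞 w(x_𝔞) φ_g(x_𝔞)` the WEIGHTED conductor-1 period
([v2]; DI08 §2.2 read at the lowest layer; LEAD memo g19 (F2), g20 (F6)).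
[cite: CastellaEtAl2025, Thm. 7.4, (7.1)–(7.2), p. 31 L9–12, p. 32 L50–63 (arXiv:2308.10474v2 pp. 30–32)]
[cite: CastellaWan2023, Prop. 4.1, Prop. 4.4, Def. 4.5, proof of Thm. 6.8 (MS pp. 18–31)] [cite: DarmonIovita2008, §2.2 and §4 (Prop. 4.3, 4.4, 4.6)]
[cite: BertoliniDarmon2005, Thm. 5.15] -/
def SpecP0P1 : Prop :=
  ∀ (N : ℕ) [NeZero N] (W : WeierstrassCurve ℚ) [W.IsGloballyMinimal] (K : Type) [Field K] [NumberField K]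
    (p : ℕ) [Fact p.Prime] (κ : ZpExtension K p) (𝔭 𝔭' : HeightOneSpectrum (𝓞 K))
    (hS : Setting W K p κ 𝔭 𝔭') (ι : PadicAlgCl p ≃+* ℂ) {f : CuspForm (CongruenceSubgroup.Gamma0 N) 2} (_ : IsNewformOf W f),
    (W.conductorNorm ℤ : ℕ) = N → SatisfiesHeegnerHypothesis N K → IsCoprime (N : ℤ) (NumberField.discr K) → 5 ≤ p →
    Surj W p → (∀ (w : InfinitePlace K) (k : 𝓞 K), k ∈ 𝔭.asIdeal ↔ ‖ι.symm (w.embedding (k : K))‖ < 1) →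
    ∀ (γ : absoluteGaloisGroup K) (hγ : κ.IsTopGenerator γ) (h𝔭 : IsNonsplitIn κ 𝔭)
      (γ𝔭 : absoluteGaloisGroup (𝔭.adicCompletion K))
      (hγ𝔭 : κ (resGalOfEmb (closureEmb (K := K) (𝔭.adicCompletion K)) γ𝔭) = κ γ),
      ∃ (ΩK : ℂ) (Ωp : (unrIntegers p)ˣ) (L : UnrSeries p), ΩK ≠ 0 ∧
        IsCWBDPLFunction ι 𝔭 κ γ f (NumberField.discr K) ΩK ((Ωp : unrIntegers p) : ℂ_[p]) L ∧
        ∃ (jbar : AlgebraicClosure K →+* ℂ) (F : HeegnerFamily N W K κ jbar), F.IsTraceCoherentApZero ∧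
          ∀ ε : ℤˣ, ∃ (z : selmerLambdaAdic (W.baseChange K) p κ γ (fun _ ↦ .sgn ε))
            (B : SignedBipartiteSystem W K p κ),
            IsSignedBipartiteSystem W K p κ γ N ε B ∧ B.IsLimitBaseClass z.1 ∧ IsSignedHeegnerClass p κ γ F ε z.1 ∧
            TransferInputs (W.baseChange K) p κ γ hγ 𝔭 h𝔭 γ𝔭 hγ𝔭 𝔭' (fun h ↦ hS.ne h.symm) hS.mem ε z L ∧
            -- DICTIONARY at `j = 1`: `λ_1(m)(0)` is a unit iff the WEIGHTED conductor-1 toric period `Σ_𝔞 w(x_𝔞) φ(x_𝔞)` of the JL eigenvector is non-zero mod `p` [v2]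
            ∀ m ∈ defProducts N K (fun ℓ ↦ W.frobeniusTrace ℓ) p 1, ∀ (S : Brandt.XiSetup N m),
              ∃ φ : Brandt.ClassSet S.O → ZMod p, φ ≠ 0 ∧
                (letI : Fintype (Brandt.ClassSet S.O) := Fintype.ofFinite _
                 φ ∈ Brandt.eigenSpace (ZMod p) (N * m) (Brandt.matrix S.O) (fun ℓ ↦ W.frobeniusTrace ℓ)) ∧
                ∀ (ψ : K →ₐ[ℚ] S.D) (I : Submodule ℤ S.D), Brandt.IsGrossPoint S.O ψ I →
                  (IsUnit (PowerSeries.constantCoeff (B.lam 1 m)) ↔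
                    Brandt.toricPeriod S.O ψ I (fun i ↦ (Brandt.weight S.O i : ZMod p) * φ i) ≠ 0)

/-- **Typing target MULT1: multiplicity one modulo `p` on the definite side** — for `m ∈ 𝒩_1^def` and a definite set-up `S` of type
`(N, m)` (`N = N_E`, `ρ̄_{E,p}` onto, `p ≥ 5`, `E[p]` ramified at every `q ∣ N`), the mod-`p` eigenspace of the Brandt module of `S` for
the eigenvalues `a_ℓ(E)` (`ℓ ∤ Nm` prime) is spanned by any of its non-zero vectors.  Print: Pollack–Weston 2011 Thm. 6.2 (`S_2(N⁺, N⁻m; ℤ_p)_𝔪`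
free of rank one over `𝕋_𝔪` under CR, `N` square-free); at non-square-free `N⁺`: Kim–Ota 2023 §5 (freeness under CR⁺; CR⁺(7) ⟸
`N(ρ̄_{E,p}) = N_E`, kernel on the all-ramified cell modulo Saito at `v ∣ 2`, `Lines/koeta_sketch.lean`).  Typer flag
`mult-one-socle-vs-cosocle` (eigenvectors of the Brandt matrices = the `𝔪`-torsion of the dual module).
[cite: PollackWeston2011, Thm. 6.2] [cite: KimOta2023, Thm. 5.5, Cor. 5.7 (arXiv:1905.02926)] [cite: BertoliniDarmon2005, Thm. 5.15 (ii)] -/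
def SpecMult1 : Prop :=
  ∀ (N : ℕ) [NeZero N] (W : WeierstrassCurve ℚ) [W.IsElliptic] [W.IsGloballyMinimal] (K : Type) [Field K] [NumberField K]
    (p : ℕ) [Fact p.Prime],
    (N : ℤ) = W.conductorNorm ℤ → 5 ≤ p → Surj W p → IsImaginaryQuadratic K →
    (∀ ℓ : ℕ, ℓ.Prime → ℓ ∣ N → ((Ideal.span {(ℓ : ℤ)}).primesOver (𝓞 K)).ncard = 2) →
    (∀ q : ℕ, q.Prime → q ∣ N →
      ∃ v : HeightOneSpectrum (𝓞 ℚ), ((q : ℕ) : 𝓞 ℚ) ∈ v.asIdeal ∧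
        ∃ 𝔓 ∈ v.primesAbove, ∃ σ ∈ 𝔓.inertia (absoluteGaloisGroup ℚ),
          ∃ P : W.geomTorsion (p : ℤ), σ • P ≠ P) →
    ∀ m ∈ defProducts N K (fun ℓ ↦ W.frobeniusTrace ℓ) p 1, ∀ (S : Brandt.XiSetup N m)
      (φ₁ φ₂ : Brandt.ClassSet S.O → ZMod p),
      (letI : Fintype (Brandt.ClassSet S.O) := Fintype.ofFinite _
       φ₁ ∈ Brandt.eigenSpace (ZMod p) (N * m) (Brandt.matrix S.O) (fun ℓ ↦ W.frobeniusTrace ℓ)) →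
      (letI : Fintype (Brandt.ClassSet S.O) := Fintype.ofFinite _
       φ₂ ∈ Brandt.eigenSpace (ZMod p) (N * m) (Brandt.matrix S.O) (fun ℓ ↦ W.frobeniusTrace ℓ)) →
      φ₁ ≠ 0 → ∃ c : ZMod p, φ₂ = c • φ₁

/-! ## §2 Kernel: the registered BRIDGE text follows from the two targets -/

/-- The toric period is linear in the function: `P(c • φ) = c • P(φ)`. [folklore] -/
theorem toricPeriod_smul {K : Type} [Field K] [NumberField K] {D : Type} [Ring D] [Algebra ℚ D]
    (O : Submodule ℤ D) (ψ : K →ₐ[ℚ] D) (I : Submodule ℤ D) {p : ℕ} (c : ZMod p) (φ : Brandt.ClassSet O → ZMod p) :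
    Brandt.toricPeriod O ψ I (c • φ) = c • Brandt.toricPeriod O ψ I φ := by
  rw [Brandt.toricPeriod_def, Brandt.toricPeriod_def, Finset.smul_sum]
  refine Finset.sum_congr rfl fun 𝔞 _ ↦ ?_
  simp only [Brandt.evalAtLattice, Pi.smul_apply]
  split_ifs <;> simp

/-- The toric period of the zero function vanishes. [folklore] -/
theorem toricPeriod_zero {K : Type} [Field K] [NumberField K] {D : Type} [Ring D] [Algebra ℚ D]
    (O : Submodule ℤ D) (ψ : K →ₐ[ℚ] D) (I : Submodule ℤ D) {R : Type*} [AddCommMonoid R] :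
    Brandt.toricPeriod O ψ I (0 : Brandt.ClassSet O → R) = 0 := by
  rw [Brandt.toricPeriod_def]
  refine Finset.sum_eq_zero fun 𝔞 _ ↦ ?_
  simp only [Brandt.evalAtLattice]
  split_ifs <;> rfl

/-- **[v2] Weighting commutes with scalars**: `w • (c • φ) = c • (w • φ)` for the Gross weights `w = Brandt.weight O`. [folklore] -/
theorem weight_mul_smul {D : Type} [Ring D] (O : Submodule ℤ D) {p : ℕ} (c : ZMod p) (φ : Brandt.ClassSet O → ZMod p) :
    (fun i ↦ (Brandt.weight O i : ZMod p) * (c • φ) i) = c • fun i ↦ (Brandt.weight O i : ZMod p) * φ i := by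
  funext i
  simp only [Pi.smul_apply, smul_eq_mul]
  ring

/-- **[v2] The weighted zero function is zero**: `w • 0 = 0`. [folklore] -/
theorem weight_mul_zero {D : Type} [Ring D] (O : Submodule ℤ D) {p : ℕ} :
    (fun i ↦ (Brandt.weight O i : ZMod p) * (0 : Brandt.ClassSet O → ZMod p) i) = 0 := by
  funext i
  simp

/-- **The BRIDGE text from the two typing targets (kernel).**  Conclusion = the body of the registered text
`AdmdefLine.SignedBipartiteBridgeNS` of `Cruxes/AnticyclotomicEisensteinDivisibility/Lines/admdef.lean` v14 ([v2]: WEIGHTED period), VERBATIM.  Proof: build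
`AcSigned.Setting` from the cell binders; `SpecP0P1` at the sign `+` gives the frame, the class, the system (laws, base class) and the
transfer inputs — part (a) — and the dictionary; for part (b), at an odd Zhang-admissible level `s` the product `∏ s` lies in `𝒩_1^def`
(`…AdmdefBipartiteNVLevelOne.prod_mem_defProducts_one`), the hands' eigenvector `φ` with non-zero period is non-zero, so by `SpecMult1`
the dictionary's `φ_g` is `c • φ`... rather `φ = c • φ_g` with `c ≠ 0`, whence `P_K(w • φ_g) ≠ 0` and `λ⁺_1(∏ s)(0) ∈ ℤ_pˣ`.
[cite: CastellaEtAl2025, §7.4 L1–3, (7.4), p. 32 L50–63 (arXiv:2308.10474v2 pp. 32–33)] [cite: PollackWeston2011, Thm. 6.2] -/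
theorem bridge_text_of_spec (hP : SpecP0P1) (hM : SpecMult1) :
    ∀ {p : ℕ} [Fact p.Prime] (ι : PadicAlgCl p ≃+* ℂ) (W : WeierstrassCurve ℚ) [W.IsElliptic]
    [W.IsGloballyMinimal] (K : Type) [Field K] [NumberField K]
    (𝔭 𝔭bar : HeightOneSpectrum (𝓞 K)) (κ : ZpExtension K p) (γ : absoluteGaloisGroup K)
    [hγF : Fact (κ.IsTopGenerator γ)] {N : ℕ} [NeZero N] {f : CuspForm (CongruenceSubgroup.Gamma0 N) 2}
    (_ : IsNewformOf W f),
    (N : ℤ) = W.conductorNorm ℤ → 5 ≤ p → W.HasGoodReductionAtPrime p → W.frobeniusTrace p = 0 →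
    Surj W p →
    IsImaginaryQuadratic K → ((Ideal.span {(p : ℤ)}).primesOver (𝓞 K)).ncard = 2 →
      (h𝔭 : ((p : ℕ) : 𝓞 K) ∈ 𝔭.asIdeal) →
      (∀ (w : InfinitePlace K) (k : 𝓞 K), k ∈ 𝔭.asIdeal ↔ ‖ι.symm (w.embedding (k : K))‖ < 1) →
      ((p : ℕ) : 𝓞 K) ∈ 𝔭bar.asIdeal → (hne : 𝔭bar ≠ 𝔭) →
    (∀ ℓ : ℕ, ℓ.Prime → ℓ ∣ N → ((Ideal.span {(ℓ : ℤ)}).primesOver (𝓞 K)).ncard = 2) →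
    IsCoprime (N : ℤ) (NumberField.discr K) → ¬ p ∣ NumberField.classNumber K →
    ¬ Squarefree N →
    (∀ q : ℕ, q.Prime → q ∣ N →
      ∃ v : HeightOneSpectrum (𝓞 ℚ), ((q : ℕ) : 𝓞 ℚ) ∈ v.asIdeal ∧
        ∃ 𝔓 ∈ v.primesAbove, ∃ σ ∈ 𝔓.inertia (absoluteGaloisGroup ℚ),
          ∃ P : W.geomTorsion (p : ℤ), σ • P ≠ P) →
    κ.IsAnticyclotomic →
    ∀ (h𝔭ns : AcSigned.IsNonsplitIn κ 𝔭) (γ𝔭 : absoluteGaloisGroup (𝔭.adicCompletion K))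
      (hγ𝔭 : κ (resGalOfEmb (closureEmb (K := K) (𝔭.adicCompletion K)) γ𝔭) = κ γ),
      ∃ (ΩK : ℂ) (Ωp : (unrIntegers p)ˣ) (L : UnrSeries p), ΩK ≠ 0 ∧
        IsCWBDPLFunction ι 𝔭 κ γ f (NumberField.discr K) ΩK ((Ωp : unrIntegers p) : ℂ_[p]) L ∧
        ∃ (z : AcSigned.selmerLambdaAdic (W.baseChange K) p κ γ (fun _ ↦ .sgn 1))
          (B : CastellaHsuKunduLeeLiu2025.SignedBipartiteSystem W K p κ),
          AcSigned.TransferInputs (W.baseChange K) p κ γ hγF.out 𝔭 h𝔭ns γ𝔭 hγ𝔭 𝔭bar (fun h ↦ hne h.symm) h𝔭 1 z L ∧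
          CastellaHsuKunduLeeLiu2025.IsSignedBipartiteSystem W K p κ γ N 1 B ∧ B.IsLimitBaseClass z.1 ∧
          ∀ s : Finset ℕ, IsZhangAdmissibleLevel N K (fun ℓ ↦ W.frobeniusTrace ℓ) p s → Odd s.card →
            (∃ (S : Brandt.XiSetup N (∏ q ∈ s, q)) (ψ : K →ₐ[ℚ] S.D) (I : Submodule ℤ S.D)
                (φ : Brandt.ClassSet S.O → ZMod p),
                Brandt.IsGrossPoint S.O ψ I ∧
                (letI : Fintype (Brandt.ClassSet S.O) := Fintype.ofFinite _
                 φ ∈ Brandt.eigenSpace (ZMod p) (N * ∏ q ∈ s, q) (Brandt.matrix S.O) (fun ℓ ↦ W.frobeniusTrace ℓ)) ∧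
                Brandt.toricPeriod S.O ψ I (fun i ↦ (Brandt.weight S.O i : ZMod p) * φ i) ≠ 0) →
            IsUnit (PowerSeries.constantCoeff (B.lam 1 (∏ q ∈ s, q))) := by
  intro p _ ι W _ _ K _ _ 𝔭 𝔭bar κ γ hγF N _ f hf hN hp hgood hap hsurj hK _hsplit h𝔭 hι h𝔭bar hne hHeeg hcop hh _hnsq
    hram hac h𝔭ns γ𝔭 hγ𝔭
  have hp2 : p ≠ 2 := by omega
  have hS : Setting W K p κ 𝔭 𝔭bar :=
    { isElliptic := ‹_›
      p_ne_two := hp2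
      goodSS := ⟨hgood, by rw [hap]; exact dvd_zero _⟩
      frobeniusTrace_eq_zero := hap
      isImaginaryQuadratic := hK
      mem := h𝔭
      mem' := h𝔭bar
      ne := hne
      anticyclotomic := hac
      not_dvd_classNumber := hh }
  have hN' : (W.conductorNorm ℤ : ℕ) = N := by exact_mod_cast hN.symm
  have hHg : SatisfiesHeegnerHypothesis N K := fun ℓ hℓ hℓN ↦ hHeeg ℓ hℓ hℓN
  obtain ⟨ΩK, Ωp, L, hΩ, hBDP, jbar, F, _hF, hsign⟩ :=
    hP N W K p κ 𝔭 𝔭bar hS ι hf hN' hHg hcop hp hsurj hι γ hγF.out h𝔭ns γ𝔭 hγ𝔭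
  obtain ⟨z, B, hB, hbase, _hzF, hT, hdict⟩ := hsign 1
  refine ⟨ΩK, Ωp, L, hΩ, hBDP, z, B, hT, hB, hbase, fun s hs hodd ⟨S, ψ, I, φ, hG, hφ, hper⟩ ↦ ?_⟩
  -- the vertex `∏ s` is definite at torsion level `1`
  have hm : (∏ q ∈ s, q) ∈ defProducts N K (fun ℓ ↦ W.frobeniusTrace ℓ) p 1 :=
    SignedBaseChangeAcDivAdmdefBipartiteNVLevelOne.prod_mem_defProducts_one hs hodd
  -- the dictionary's Jacquet–Langlands vector `φ_g` and multiplicity one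
  obtain ⟨φg, hφg0, hφg, hiff⟩ := hdict (∏ q ∈ s, q) hm S
  have hφ0 : φ ≠ 0 := by
    rintro rfl
    exact hper (by rw [weight_mul_zero]; exact toricPeriod_zero S.O ψ I)
  obtain ⟨c, hc⟩ := hM N W K p hN hp hsurj hK hHeeg hram (∏ q ∈ s, q) hm S φg φ hφg hφ hφg0
  -- `φ = c • φ_g`, so `P(φ) = c • P(φ_g) ≠ 0` forces `P(φ_g) ≠ 0`
  have hPg : Brandt.toricPeriod S.O ψ I (fun i ↦ (Brandt.weight S.O i : ZMod p) * φg i) ≠ 0 := by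
    intro h0
    apply hper
    rw [hc, weight_mul_smul, toricPeriod_smul, h0, smul_zero]
  exact (hiff ψ I hG).mpr hPg

end Summit.BirchSwinnertonDyer.BirchSwinnertonDyer.Cruxes.AnticyclotomicEisensteinDivisibility.AdmdefBridgeSpec

end
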